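import Summits.HodgeConjecture.HodgeConjecture.Theses.AnchorTransport
import Summits.HodgeConjecture.HodgeConjecture.Theorems.AnchorTransportVariationalHodgeOperatorSupply
import Summits.HodgeConjecture.HodgeConjecture.Theorems.AnchorTransportTargetIffHodgeConjecture

/-!
# Disproof of `VariationalHodge` (crux stmt-HodgeConjecture-1076, route AnchorTransport) — findings

Standing disprover's work file (refuter-cdisprove-stmt-HodgeConjecture-1076-0, cycle 1, 2026-08-16).
Prose lives in docstrings; every `theorem` below is kernel-checked (0 sorries).

## Verdict of cycle 1: NO KILL is possible short of disproving the Hodge conjecture as formalised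

* `hodgeConjecture_imp` / `not_hodgeConjecture_of_not` (§1): `HodgeConjecture → VariationalHodge` on the
  nose (landed `variationalHodge_of_hodgeConjecture`, 2 lines, the base hypotheses and the anchor
  UNUSED). Hence `¬ VariationalHodge → ¬ HodgeConjecture`: an unconditional refutation of this crux is a
  refutation of the summit statement itself. The summit statement's only junk valve is
  `IsOfHodgeType := ∃ HodgeModel, …` (an exotic model could only ENLARGE the Hodge classes); using it
  would need (i) an exotic `HodgeModel` (blocked: `IsAnalytification.unique` + naturality of the de
  Rham family ⇒ scalar ambiguity only) and (ii) a COMPUTED non-algebraic rational class on a specific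
  smooth projective variety — the tree computes no `H²ᵖ(X(ℂ); ℂ)`, `0 < p < dim X`, of any
  positive-dimensional smooth projective `X`. Junk audit of `algebraicClasses` (§4): the order on
  scheme points is Mathlib's specialisation preorder `x ≤ y ↔ y ⤳ x` (closed points minimal, generic
  point maximal), so `Order.coheight` = codimension as the docstring claims; no valve there.

## Load-bearing analysis (§2) — which hypothesis carries content

* ANCHOR `∃ s₀, A|_{𝒳_{s₀}} algebraic`: carries EVERYTHING. `withoutAnchor_iff_hodgeConjecture`:
  the crux with the anchor deleted is LITERALLY EQUIVALENT to `HodgeConjecture` (constant family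
  `X ⟶ Spec ℂ`). So "any proof must use the anchor" holds in the strongest sense, and
  `VariationalHodgeWithoutAnchor` is exactly as unrefutable as the summit.
* BASE HYPOTHESES `IrreducibleSpace S.left`, `Smooth S.hom`: NOT load-bearing for the truth value
  (`withoutBaseHyps_of_hodgeConjecture`: HC ⇒ the crux over arbitrary bases). Classically the version
  over a disconnected base `Spec ℂ ⊔ Spec ℂ` is again equivalent to HC (fibres unrelated), so
  irreducibility is what separates Grothendieck's V (believed weaker than HC: implied by the standard
  conjectures, Charles–Schnell remark after Thm 11.3.8) from HC — a distinction no kernel check can see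
  today. For a smooth `S`, irreducible ⇔ connected and nonempty, and the provers' landed
  `variationalHodge_of_affine` shows non-separated / non-quasi-compact bases are harmless (chain of
  affine opens), so the missing `IsSeparated`/`QuasiCompact` on `S` is NOT a misstatement.
* FIBREWISE `IsRationalClass ∧ IsOfHodgeType (p,p)` at `s ≠ s₀`: classically REDUNDANT given the
  anchor (theorem of the fixed part, Deligne Hodge II 4.1.1 + Charles–Schnell Prop. 11.3.5: the flat
  section `s ↦ A|_{𝒳_s}` lies in the fixed part; `A|_{s₀} ∈ (Alg ∩ Fixed_ℚ) ⊗ ℂ`; invariant rational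
  algebraic classes at `s₀` extend to global rational classes that are `(p,p)` everywhere). In the
  tree this is `charlesSchnell_hodgeClass_of_flat` + `deligne_globalInvariantCycles` (NAMED FACTS,
  quasi-projective base) plus a rationality-of-the-fixed-part step not yet vendored. Information for
  the prover: these hypotheses give NO leverage away from the anchor fibre; the sandwich proof uses them
  only AT the target fibre `s`. `anchorOnly_imp` records the trivial direction.
* RELATIVE PROJECTIVITY (prover seat -2's standing `verdict-misstated`): from the refuter's chair the
  omission does not make the decl refutable — `IsSmoothProjectiveFamily` (smooth + proper + projective
  fibres) ⊋ projective morphisms (Atiyah-flop families), so the tree's V is FORMALLY STRONGER than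
  Charles–Schnell Conj. 11.3.1 but still ⇐ HC fibrewise; `anchorTransport_projVariationalHodge_of_
  variationalHodge` (landed) gives V ⇒ V_proj. Not misstated in the refutable sense; whether to
  restate is a planner's modelling choice (engines are vendored for projective morphisms).

## Natural strengthenings / weakenings that ARE classically false (none typable + checkable today)

* analytic simply-connected base (Charles–Schnell remark after Conj. 11.3.2) — bases are schemes here;
* flat-section form WITHOUT the Hodge condition along the path ("`u` algebraic at `s₀`, transported
  flat ⇒ algebraic at `s₁`"): false by Noether–Lefschetz jumping (graph of an isogeny on `E × E'`
  deformed off the CM locus); typable via the tree's `transportFun`, but a proof of falsity needs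
  `H²((E×E')(ℂ))` computed with its Hodge types — out of reach; NOT recorded as a sorried theorem.
* integral coefficients (Kollár / Atiyah–Hirzebruch torsion) — the tree's `algebraicClasses` is a
  `ℂ`-subspace, so integral phenomena are invisible by design.

## Line `Sketch` (lead prover-line-stmt-HodgeConjecture-1076-0; payload.targets = ∅)

Its one stub `stub_anchoredOperatorSupply` ↔ the crux (landed p96133,
`anchoredOperatorSupply_iff_variationalHodge`), hence HC ⇒ stub (`sketchStub_of_hodgeConjecture`, §3):
the stub is as unrefutable as the summit; the lead already declared the line dead as a COSTUME
(`Lines/Sketch-dead.md`). Nothing else to target this cycle.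

## WHY IT RESISTS (for ideators/planners)

Every refutation handle on V is closed by the fibrewise sandwich HC ⇒ V. A disprover can only bite a
REFORMULATION that is not fibrewise HC-implied: (a) the flat-section form before finite base change,
(b) statements positing transport OPERATORS with extra structure (correspondence classes acting
through a `GysinFormalism`, relative cycles) — but (b) is sandwiched between V and V + Poincaré
duality (lead's analysis), and (a) needs computed cohomology. The first kernel-checkable negative
result in this area requires ONE computed example: `H²` of a product of two elliptic curves (or of an
abelian surface) with its Hodge decomposition and Néron–Severi rank on real carriers.
-/

noncomputable section

set_option linter.dupNamespace false

open CategoryTheory AlgebraicGeometry CategoryTheory.Limits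
open Literature.AlgebraicGeometry Literature.AlgebraicGeometry.Motives
  Literature.AlgebraicGeometry.HodgeTheory Literature.AlgebraicTopology.SingularHomology
open Summit.HodgeConjecture.HodgeConjecture.Theses.AnchorTransport
open Summit.HodgeConjecture.HodgeConjecture.Theorems

namespace Summit.HodgeConjecture.HodgeConjecture.Cruxes.VariationalHodge.Disproof

/-! ### §1 The sandwich `HodgeConjecture ⇒ VariationalHodge` and its contrapositive -/

/-- `HC ⇒ V` (landed `variationalHodge_of_hodgeConjecture`; base hypotheses and anchor unused).
[cite: CharlesSchnell2014Notes, Cor. 11.3.6] -/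
theorem hodgeConjecture_imp : _root_.HodgeConjecture → VariationalHodge :=
  variationalHodge_of_hodgeConjecture

/-- **A kill of the crux is a disproof of the summit**: `¬ V ⇒ ¬ HC`. [folklore] -/
theorem not_hodgeConjecture_of_not : ¬ VariationalHodge → ¬ _root_.HodgeConjecture :=
  mt hodgeConjecture_imp

/-! ### §2 Load-bearing analysis -/

/-- The crux with the ANCHOR hypothesis `∃ s₀, A|_{𝒳_{s₀}} ∈ algebraicClasses` deleted: every
fibrewise rational `(p,p)` global class on a smooth projective family over a smooth irreducible base is
fibrewise algebraic. [folklore] -/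
def VariationalHodgeWithoutAnchor : Prop :=
  ∀ ⦃n : ℕ⦄ ⦃𝒳 S : SchemeOver ℂ⦄ (f : 𝒳 ⟶ S), IsSmoothProjectiveFamily f n →
    IrreducibleSpace S.left → AlgebraicGeometry.Smooth S.hom →
    ∀ (p : ℕ) (A : complexBetti 𝒳 (2 * p)),
    (∀ s : ComplexPoints S, IsRationalClass (complexBetti.map (fiberι f s) (2 * p) A) ∧
      IsOfHodgeType n (fiberOver f s) (2 * p) p p (complexBetti.map (fiberι f s) (2 * p) A)) →
    ∀ s : ComplexPoints S,
      complexBetti.map (fiberι f s) (2 * p) A ∈ algebraicClasses (fiberOver f s) p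

/-- Deleting the anchor only strengthens the crux. [folklore] -/
theorem variationalHodge_of_withoutAnchor (h : VariationalHodgeWithoutAnchor) : VariationalHodge :=
  fun _ _ _ f hf hirr hsm p A hA _ s => h f hf hirr hsm p A hA s

/-- `HC ⇒` the anchor-free form (fibrewise, exactly as for the crux). [folklore] -/
theorem withoutAnchor_of_hodgeConjecture (h : _root_.HodgeConjecture) : VariationalHodgeWithoutAnchor :=
  fun _ _ _ _ hf _ _ p _ hA s => (h (hf.isSmoothProjective s)).2 p _ (hA s).1 (hA s).2

/-- **The anchor-free form implies the Hodge conjecture**: read a rational `(p,p)` class `c` on a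
smooth projective `X` as a global class on the CONSTANT family `X ⟶ Spec ℂ` (smooth projective family
over the smooth irreducible base `Spec ℂ`; every fibre inclusion is an isomorphism, along which
rationality and Hodge type transport), conclude algebraicity on the fibre and transport it back along
the inverse isomorphism. [folklore] -/
theorem hodgeConjecture_of_withoutAnchor (h : VariationalHodgeWithoutAnchor) : _root_.HodgeConjecture := by
  intro n X hX
  refine (hodgeConjectureFor_iff_of_isSmoothProjective nonempty_hodgeModel_holds hX).2 ?_
  intro p c hc hpp
  haveI : ∀ s : AlgPoints (specOver ℂ ℂ) ℂ, IsIso (fiberι (toSpecOver X) s) := isIso_fiberι_toSpecOver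
  have hfam : IsSmoothProjectiveFamily (toSpecOver X) n := isSmoothProjectiveFamily_toSpecOver hX
  -- the anchor-free statement on the constant family, at the point `𝟙 (Spec ℂ)`
  have key := h (toSpecOver X) hfam irreducibleSpace_specOver_left smooth_specOver_hom p c
    (fun s => ⟨hc.pullback _, IsOfHodgeType.map_of_iso (asIso (fiberι (toSpecOver X) s)) hpp⟩) (𝟙 _)
  -- transport back along the inverse of the fibre isomorphism `X_{𝟙} ≅ X`
  have back := mem_algebraicClasses_map_of_iso (hfam.isSmoothProjective (𝟙 _)) hX
    (asIso (fiberι (toSpecOver X) (𝟙 _))).symm key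
  have hid : complexBetti.map (asIso (fiberι (toSpecOver X) (𝟙 _))).symm.hom (2 * p)
      (complexBetti.map (fiberι (toSpecOver X) (𝟙 _)) (2 * p) c) = c := by
    change (complexBetti.map (asIso (fiberι (toSpecOver X) (𝟙 _))).hom (2 * p) ≫
      complexBetti.map (asIso (fiberι (toSpecOver X) (𝟙 _))).inv (2 * p)) c = c
    rw [← complexBetti.map_comp, Iso.inv_hom_id, complexBetti.map_id]
    rfl
  rwa [hid] at back

/-- **The anchor carries the whole content of the crux**: with it deleted, the crux IS the Hodge
conjecture. In particular `VariationalHodgeWithoutAnchor` is refutable only by refuting the summit,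
and no `_false_without_anchor` theorem can exist short of `¬ HodgeConjecture`. [folklore] -/
theorem withoutAnchor_iff_hodgeConjecture : VariationalHodgeWithoutAnchor ↔ _root_.HodgeConjecture :=
  ⟨hodgeConjecture_of_withoutAnchor, withoutAnchor_of_hodgeConjecture⟩

/-- The crux with BOTH base hypotheses (`IrreducibleSpace S.left`, `Smooth S.hom`) deleted: arbitrary
base `ℂ`-scheme. [folklore] -/
def VariationalHodgeWithoutBaseHyps : Prop :=
  ∀ ⦃n : ℕ⦄ ⦃𝒳 S : SchemeOver ℂ⦄ (f : 𝒳 ⟶ S), IsSmoothProjectiveFamily f n →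
    ∀ (p : ℕ) (A : complexBetti 𝒳 (2 * p)),
    (∀ s : ComplexPoints S, IsRationalClass (complexBetti.map (fiberι f s) (2 * p) A) ∧
      IsOfHodgeType n (fiberOver f s) (2 * p) p p (complexBetti.map (fiberι f s) (2 * p) A)) →
    (∃ s₀ : ComplexPoints S,
      complexBetti.map (fiberι f s₀) (2 * p) A ∈ algebraicClasses (fiberOver f s₀) p) →
    ∀ s : ComplexPoints S,
      complexBetti.map (fiberι f s) (2 * p) A ∈ algebraicClasses (fiberOver f s) p

/-- Deleting the base hypotheses only strengthens the crux. [folklore] -/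
theorem variationalHodge_of_withoutBaseHyps (h : VariationalHodgeWithoutBaseHyps) : VariationalHodge :=
  fun _ _ _ f hf _ _ p A hA hs₀ s => h f hf p A hA hs₀ s

/-- **The base hypotheses are not load-bearing for the truth value**: `HC ⇒` the crux over an
ARBITRARY base (reducible, singular, non-separated …), fibrewise. So irreducibility/smoothness of `S`
cannot be shown necessary by any kernel-checkable witness short of `¬ HodgeConjecture`; they are
load-bearing only for the transport MECHANISM (over `Spec ℂ ⊔ Spec ℂ` the statement is classically
equivalent to HC again, the two fibres being unrelated). [folklore] -/
theorem withoutBaseHyps_of_hodgeConjecture (h : _root_.HodgeConjecture) : VariationalHodgeWithoutBaseHyps :=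
  fun _ _ _ _ hf p _ hA _ s => (h (hf.isSmoothProjective s)).2 p _ (hA s).1 (hA s).2

/-- The ANCHOR-ONLY form: no rationality and no Hodge-type hypothesis on any fibre — a global class
algebraic (i.e. in the `ℂ`-span of cycle classes) on one fibre is algebraic on every fibre.
Classically this is STILL implied by HC for projective `f` (theorem of the fixed part + semisimplicity:
`A|_{s₀} ∈ (Alg(𝒳_{s₀}) ∩ H^{2p}(𝒳_{s₀};ℚ)^{π₁}) ⊗ ℂ`, and invariant rational algebraic classes extend
to global rational classes of type `(p,p)` on every fibre, Charles–Schnell Prop. 11.3.5), so it is not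
a refutation target either; in the tree the implication needs the named facts
`deligne_globalInvariantCycles`, `charlesSchnell_hodgeClass_of_flat` and a rational structure on the
fixed part (not vendored). Recorded to tell the prover that the fibrewise hypotheses of the crux give
no leverage away from the target fibre. [cite: CharlesSchnell2014Notes, Prop. 11.3.5] -/
def VariationalHodgeAnchorOnly : Prop :=
  ∀ ⦃n : ℕ⦄ ⦃𝒳 S : SchemeOver ℂ⦄ (f : 𝒳 ⟶ S), IsSmoothProjectiveFamily f n →
    IrreducibleSpace S.left → AlgebraicGeometry.Smooth S.hom →
    ∀ (p : ℕ) (A : complexBetti 𝒳 (2 * p)),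
    (∃ s₀ : ComplexPoints S,
      complexBetti.map (fiberι f s₀) (2 * p) A ∈ algebraicClasses (fiberOver f s₀) p) →
    ∀ s : ComplexPoints S,
      complexBetti.map (fiberι f s) (2 * p) A ∈ algebraicClasses (fiberOver f s) p

/-- The anchor-only form implies the crux (trivial direction; the converse is the classical
fixed-part argument, not available unconditionally in the tree). [folklore] -/
theorem variationalHodge_of_anchorOnly (h : VariationalHodgeAnchorOnly) : VariationalHodge :=
  fun _ _ _ f hf hirr hsm p A _ hs₀ s => h f hf hirr hsm p A hs₀ s

/-! ### §3 Line `Sketch`: its one stub is HC-implied (no stub kill possible) -/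

/-- `HC ⇒ stub_anchoredOperatorSupply` (the stub is equivalent to the crux, p96133, and the crux is
HC-implied): the only typable stub of line `Sketch` is as unrefutable as the summit. [folklore] -/
theorem sketchStub_of_hodgeConjecture (h : _root_.HodgeConjecture) :
    ∀ ⦃n : ℕ⦄ ⦃𝒳 S : SchemeOver ℂ⦄ (f : 𝒳 ⟶ S), IsSmoothProjectiveFamily f n →
      IrreducibleSpace S.left → IsAffine S.left → AlgebraicGeometry.Smooth S.hom →
      ∀ (p : ℕ) (A : complexBetti 𝒳 (2 * p)),
      (∀ s : ComplexPoints S, IsRationalClass (complexBetti.map (fiberι f s) (2 * p) A) ∧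
        IsOfHodgeType n (fiberOver f s) (2 * p) p p (complexBetti.map (fiberι f s) (2 * p) A)) →
      ∀ s₀ : ComplexPoints S,
        complexBetti.map (fiberι f s₀) (2 * p) A ∈ algebraicClasses (fiberOver f s₀) p →
      ∃ T : ∀ t : ComplexPoints S,
          complexBetti (fiberOver f s₀) (2 * p) → complexBetti (fiberOver f t) (2 * p),
        (∀ (t : ComplexPoints S) (c : complexBetti (fiberOver f s₀) (2 * p)),
          c ∈ algebraicClasses (fiberOver f s₀) p → T t c ∈ algebraicClasses (fiberOver f t) p) ∧
        ∃ α₀ : complexBetti (fiberOver f s₀) (2 * p), α₀ ∈ algebraicClasses (fiberOver f s₀) p ∧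
          (∃ Gl : complexBetti 𝒳 (2 * p), ∀ t : ComplexPoints S,
            T t α₀ = complexBetti.map (fiberι f t) (2 * p) Gl) ∧
          T s₀ α₀ = complexBetti.map (fiberι f s₀) (2 * p) A :=
  anchoredOperatorSupply_iff_variationalHodge.2 (hodgeConjecture_imp h)

/-! ### §4 Junk audit of the carriers (closed valves) -/

/-- The order on the points of a `ℂ`-scheme used by `Order.coheight` in `supportedClasses` /
`algebraicClasses` is Mathlib's specialisation preorder `x ≤ y ↔ y ⤳ x`: a generic point is ABOVE
its specialisations, closed points are minimal, so `Order.coheight z` is the codimension of the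
closure of `z` (as the docstring of `AlgebraicClasses` claims) — not the dimension. Had the order been
the opposite one, `algebraicClasses X p = ⊥` for all `p ≥ 1` and the summit would be refutable by any
non-zero point class. [folklore] -/
theorem le_iff_specializes (X : SchemeOver ℂ) (x y : X.left) : x ≤ y ↔ y ⤳ x := Iff.rfl

/-- The instance is literally `specializationPreorder`. [folklore] -/
theorem preorder_eq_specializationPreorder (X : SchemeOver ℂ) :
    (inferInstance : Preorder X.left) = specializationPreorder X.left := rfl

end Summit.HodgeConjecture.HodgeConjecture.Cruxes.VariationalHodge.Disproof

end
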